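import Mathlib
import Summits.NavierStokesRegularity.NavierStokesRegularity.Theses.ImplosionDoor
import Summits.NavierStokesRegularity.NavierStokesRegularity.Theorems.ImplosionDoorImplosionZoomFading
import Summits.NavierStokesRegularity.NavierStokesRegularity.Theorems.LocalVelCompTubeDoorLocalPointZoomVelSlices
import HarnessLib

/-!
# `ImplosionDoor.ImplosionZoom` — local point zoom with imploding slices
  (item stmt-NavierStokesRegularity-25308)

**Statement (verbatim route decl).** Under the frame hypotheses (classical NS on `[0,T)`,
Leray–Hopf, rapidly decaying datum, locally Type I at `(x₀, T)` on `B(x₀,ρ) × (T−ρ², T)`), the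
door hypothesis — for every `R > 0` the positive part of the radial functional of the
similarity-rescaled velocity fades in mean square on `B_R`,
`∫_{B_R} (max(⟪√(T−t) u(t, x₀ + √(T−t) y), y⟫, 0))² dy → 0` as `t → T⁻` — and failure of backward
boundedness at `(x₀, T)` yield `C` and a profile `v` of the Type-I ancient Oseen-mild class,
backward singular at the apex, with `⟪v(s,y), y⟫ ≤ 0` for all `s < 0` and all `y`.

PROOF. The tree's local point zoom with VELOCITY slices
(`LocalVelCompTubeDoorLocalPointZoomVelSlices.localPointZoomVelSlices`) gives `C, v, λ_j → 0⁺` with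
`(λ_j/ν) u(T + λ_j²s/ν, x₀ + λ_j y) → v(s,y)` for every `s < 0` and `y`. Fix `s < 0` and put
`t_j = T + λ_j² s/ν → T⁻`, `c = √(−s/ν)`, so `√(T − t_j) = λ_j c`; then the door functional at time
`t_j` and similarity point `y'` is `F_j(y') = ⟪(νc)·(λ_j/ν) u(t_j, x₀ + λ_j (c y')), y'⟫ →
g(y') = ⟪(νc) v(s, c y'), y'⟫`, a continuous function of `y'`, while the door hypothesis along
`t_j` says `∫_{B_R} (max(F_j, 0))² → 0` for every `R`. The fading lemma
(`ZoomFading.nonpos_of_fading_posPart`: Fatou + continuity) gives `g ≤ 0`, i.e.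
`⟪v(s,y), y⟫ ≤ 0` at `y = c y'`.

HONEST FRAMING: a compactness/bookkeeping lemma about a HYPOTHETICAL locally Type-I blow-up
(support item of a door route); nothing here bears on Navier–Stokes regularity.
-/

noncomputable section

set_option linter.dupNamespace false

namespace Summit.NavierStokesRegularity.NavierStokesRegularity.Theorems

open MeasureTheory Set Filter Topology Metric Function
open Literature.Analysis Literature.Analysis.FluidPDE
open scoped RealInnerProductSpace InnerProductSpace ENNReal

open LocalVelCompTubeDoorLocalPointZoomVelSlices ZoomFading in
/-- **Item stmt-NavierStokesRegularity-25308** (`ImplosionDoor.ImplosionZoom`): at a locally Type-I,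
not backward bounded point whose similarity-rescaled radial velocity functional has fading
positive part on every window, the local point zoom limit is a Type-I ancient Oseen-mild profile,
backward singular at the apex, with imploding slices `⟪v(s,y), y⟫ ≤ 0`.
[cite: KochNadirashviliSereginSverak2009, §5–6; SereginSverak2009, §3] -/
theorem implosionDoor_implosionZoom_proof :
    Summit.NavierStokesRegularity.NavierStokesRegularity.Theses.ImplosionDoor.ImplosionZoom := by
  unfold Summit.NavierStokesRegularity.NavierStokesRegularity.Theses.ImplosionDoor.ImplosionZoom
  intro ν T hν hT u p hsol hLH hdec x₀ ρ M hρ hM himp hnotbd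
  obtain ⟨C, v, lam, hlam, hlam0, hclass, hsing, hzoom⟩ :=
    localPointZoomVelSlices ν T hν hT u p hsol hLH hdec x₀ ρ M hρ hM hnotbd
  refine ⟨C, v, hclass, hsing, fun s hs y => ?_⟩
  obtain ⟨-, hcont, -, -⟩ := hclass
  -- the slice `v s` is continuous
  have hvs : Continuous (v s) :=
    hcont.comp_continuous (continuous_const.prodMk continuous_id) fun y => ⟨hs, mem_univ _⟩
  -- the similarity factor `c = √(−s/ν)` and the zoom times `t_j = T + λ_j² s/ν → T⁻`
  have hsν : 0 < -s / ν := div_pos (neg_pos.2 hs) hν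
  set c : ℝ := Real.sqrt (-s / ν) with hcdef
  have hc : 0 < c := Real.sqrt_pos.2 hsν
  set tj : ℕ → ℝ := fun j => T + lam j ^ 2 * s / ν with htjdef
  have htjT : ∀ j, tj j < T := fun j => by
    have : lam j ^ 2 * s / ν < 0 :=
      div_neg_of_neg_of_pos (mul_neg_of_pos_of_neg (pow_pos (hlam j) 2) hs) hν
    simp only [htjdef]; linarith
  have htj_sub : ∀ j, T - tj j = lam j ^ 2 * (-s / ν) := fun j => by
    simp only [htjdef]; ring
  have hsqrt : ∀ j, Real.sqrt (T - tj j) = lam j * c := fun j => by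
    rw [htj_sub, Real.sqrt_mul (sq_nonneg _), Real.sqrt_sq (hlam j).le]
  have htj_nhds : Tendsto tj atTop (𝓝 T) := by
    have h1 : Tendsto (fun j => T + lam j ^ 2 * s / ν) atTop (𝓝 (T + 0 ^ 2 * s / ν)) :=
      (((hlam0.pow 2).mul_const s).div_const ν).const_add T
    simpa using h1
  have htj_tend : Tendsto tj atTop (𝓝[<] T) :=
    tendsto_nhdsWithin_iff.2 ⟨htj_nhds, Eventually.of_forall htjT⟩
  -- eventually the zoom times are physical: `t_j ∈ [0, T)`
  obtain ⟨N, hN⟩ : ∃ N : ℕ, ∀ j ≥ N, 0 ≤ tj j := by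
    obtain ⟨N, hN⟩ := eventually_atTop.1 (htj_nhds.eventually (lt_mem_nhds hT))
    exact ⟨N, fun j hj => (hN j hj).le⟩
  have htjI : ∀ j, tj (j + N) ∈ Ico 0 T := fun j =>
    ⟨hN _ (Nat.le_add_left N j), htjT _⟩
  -- the door functionals along the (shifted) zoom times and their pointwise limit
  set F : ℕ → EuclideanSpace ℝ (Fin 3) → ℝ := fun j y' =>
    ⟪Real.sqrt (T - tj (j + N)) • u (tj (j + N)) (x₀ + Real.sqrt (T - tj (j + N)) • y'), y'⟫_ℝ
    with hFdef
  set g : EuclideanSpace ℝ (Fin 3) → ℝ := fun y' => ⟪(ν * c) • v s (c • y'), y'⟫_ℝ with hgdef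
  have hg : Continuous g := by
    have h1 : Continuous fun y' : EuclideanSpace ℝ (Fin 3) => c • y' := continuous_const_smul c
    have h2 : Continuous fun y' : EuclideanSpace ℝ (Fin 3) => v s (c • y') := hvs.comp h1
    exact (h2.const_smul (ν * c)).inner continuous_id
  have hF : ∀ j, Measurable (F j) := by
    intro j
    have huc : Continuous (u (tj (j + N))) := (hsol.contDiff_velocity (htjI j)).continuous
    have h1 : Continuous fun y' : EuclideanSpace ℝ (Fin 3) =>
        x₀ + Real.sqrt (T - tj (j + N)) • y' :=
      continuous_const.add (continuous_const_smul _)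
    exact (((huc.comp h1).const_smul (Real.sqrt (T - tj (j + N)))).inner continuous_id).measurable
  have hlimF : ∀ y', Tendsto (fun j => F j y') atTop (𝓝 (g y')) := by
    intro y'
    -- the zoom at the point `c • y'`, shifted by `N`, scaled by `ν c`, paired with `y'`
    have hz := ((hzoom s hs (c • y')).comp (tendsto_add_atTop_nat N)).const_smul (ν * c)
    have hz' := hz.inner (𝕜 := ℝ) (tendsto_const_nhds (x := y'))
    refine hz'.congr fun j => ?_
    simp only [hFdef, Function.comp_apply]
    congr 1
    rw [hsqrt, smul_smul, mul_smul (lam (j + N)) c y']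
    congr 1
    field_simp
  have hfadeF : ∀ R : ℝ, 0 < R → Tendsto (fun j => ∫⁻ y' in ball (0 : EuclideanSpace ℝ (Fin 3)) R,
      ENNReal.ofReal ((max (F j y') 0) ^ 2)) atTop (𝓝 0) := by
    intro R hR
    exact ((himp R hR).comp htj_tend).comp (tendsto_add_atTop_nat N)
  -- the fading lemma: `g ≤ 0`; read it at `y' = c⁻¹ • y`
  have hgy := nonpos_of_fading_posPart hg hF hlimF hfadeF (c⁻¹ • y)
  have hcy : c • c⁻¹ • y = y := by rw [smul_smul, mul_inv_cancel₀ hc.ne', one_smul]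
  simp only [hgdef, hcy, real_inner_smul_left, real_inner_smul_right] at hgy
  have hνinner : ν * ⟪v s y, y⟫_ℝ ≤ 0 := by
    have e : ν * c * (c⁻¹ * ⟪v s y, y⟫_ℝ) = ν * ⟪v s y, y⟫_ℝ := by
      field_simp
    linarith [e]
  by_contra hpos
  push Not at hpos
  linarith [mul_pos hν hpos]

end Summit.NavierStokesRegularity.NavierStokesRegularity.Theorems

end
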